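import Summits.NavierStokesRegularity.NavierStokesRegularity.Theorems.ExtremiserTransienceNearExtremalTransienceExtremiserLiouvilleConstantSpeedSlideAverageBound
import Summits.NavierStokesRegularity.NavierStokesRegularity.Theorems.ExtremiserTransienceNearExtremalTransienceExtremiserLiouvilleConstantSpeedSlideVariationLimitJ
import HarnessLib

/-!
# Crux `ExtremiserTransience.NearExtremalTransience` (stmt-NavierStokesRegularity-21883), line `extremiser_liouville`,
# stub K1b — PAIRING TOOLS for the `h → 0⁺` limit of the palinstrophy bound (record §13, R4′ tools)

`--supports stmt-NavierStokesRegularity-21883` (helper).  Author: prover seat `ns-el-k1b` (g9).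

The palinstrophy bound along the discrete slide (`palinstrophy_slideQuotient_le`, …SlidePalinstrophyBound) is a sum of
Frobenius-type pairings `∫ Σᵢ ⟪Dω(x)bᵢ, Ψ_h(x)bᵢ⟫` of the FIXED `L²` map `Dω` with `L(ℝ³,ℝ³)`-valued maps `Ψ_h`
(backward quotients of the remainder `R`, sliding averages).  This file supplies the generic tools:
* `memLp_verticalAverage` : vertical sliding averages `h⁻¹∫_{−h}^{0}K(· + te₂)dt` of a continuous `L²` map are
  continuous and in `L²` (…SlideAverageBound);
* `abs_sum_inner_apply_le` : `|Σᵢ ⟪φ bᵢ, ψ bᵢ⟫| ≤ 3‖φ‖‖ψ‖`;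
* `integrable_sum_inner_apply`, `abs_integral_sum_inner_apply_le` : the pairing of two continuous `L²` maps is
  integrable and `≤ 3·√(∫‖φ‖²)·√(∫‖ψ‖²)` (Cauchy–Schwarz);
* `tendsto_integral_sum_inner_apply` : **if `Ψ_h → Ψ₀` in `L²` then `∫Σᵢ⟪φ bᵢ, Ψ_h bᵢ⟫ → ∫Σᵢ⟪φ bᵢ, Ψ₀ bᵢ⟫`**.

WHAT THIS IS NOT: K1b is NOT proved; nothing here proves NS regularity. [folklore]
-/

noncomputable section

open Set Filter Topology MeasureTheory Metric Function InnerProductSpace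
open scoped ENNReal NNReal Topology InnerProductSpace RealInnerProductSpace ContDiff
open Literature.Analysis.FluidPDE Literature.Analysis

namespace Summit.NavierStokesRegularity.NavierStokesRegularity.Theorems

-- the problem directory repeats the summit name (`NavierStokesRegularity/NavierStokesRegularity`)
set_option linter.dupNamespace false

namespace ExtremiserLiouville

open DepletionLadder.KStar

variable {F' : Type*} [NormedAddCommGroup F'] [NormedSpace ℝ F'] [CompleteSpace F']

/-! ## 1. Sliding averages stay in `L²` -/

/-- **Vertical sliding averages of a continuous `L²` map are continuous and in `L²`** (`h > 0`). [folklore] -/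
theorem memLp_verticalAverage {K : EuclideanSpace ℝ (Fin 3) → F'} (hK : Continuous K)
    (hK2 : MemLp K 2 (volume : Measure (EuclideanSpace ℝ (Fin 3)))) {h : ℝ} (hh : 0 < h) :
    Continuous (fun x : EuclideanSpace ℝ (Fin 3) => h⁻¹ • ∫ t in (-h)..0, K (x + t • EuclideanSpace.single (2 : Fin 3) (1 : ℝ))) ∧
      MemLp (fun x : EuclideanSpace ℝ (Fin 3) => h⁻¹ • ∫ t in (-h)..0, K (x + t • EuclideanSpace.single (2 : Fin 3) (1 : ℝ))) 2
        (volume : Measure (EuclideanSpace ℝ (Fin 3))) := by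
  set e₂ : EuclideanSpace ℝ (Fin 3) := EuclideanSpace.single (2 : Fin 3) (1 : ℝ) with he₂
  have cu : Continuous (uncurry fun (x : EuclideanSpace ℝ (Fin 3)) (t : ℝ) => K (x + t • e₂)) :=
    hK.comp (continuous_fst.add (continuous_snd.smul continuous_const))
  have cI : Continuous fun x : EuclideanSpace ℝ (Fin 3) => ∫ t in (-h)..0, K (x + t • e₂) :=
    intervalIntegral.continuous_parametric_intervalIntegral_of_continuous' cu (-h) 0
  have cA : Continuous fun x : EuclideanSpace ℝ (Fin 3) => h⁻¹ • ∫ t in (-h)..0, K (x + t • e₂) := cI.const_smul h⁻¹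
  refine ⟨cA, (memLp_two_iff_integrable_sq_norm cA.aestronglyMeasurable).2 (integrable_sq_norm_of_lintegral cA ?_)⟩
  refine lt_of_le_of_lt (lintegral_verticalAverage_sq_le hK hh) ?_
  rw [lintegral_enorm_sq_eq_eLpNorm_sq]
  exact ENNReal.pow_lt_top hK2.eLpNorm_lt_top

/-! ## 2. Frobenius-type pairings of `L(ℝ³, ℝ³)`-valued `L²` maps -/

/-- The standard basis vectors have norm one. [folklore] -/
theorem norm_basisFun_eq_one (i : Fin 3) : ‖EuclideanSpace.basisFun (Fin 3) ℝ i‖ = 1 := by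
  rw [EuclideanSpace.basisFun_apply, PiLp.norm_single, norm_one]

/-- **`|Σᵢ ⟪φ bᵢ, ψ bᵢ⟫| ≤ 3‖φ‖‖ψ‖`**. [folklore] -/
theorem abs_sum_inner_apply_le (φ ψ : EuclideanSpace ℝ (Fin 3) →L[ℝ] EuclideanSpace ℝ (Fin 3)) :
    |∑ i : Fin 3, ⟪φ (EuclideanSpace.basisFun (Fin 3) ℝ i), ψ (EuclideanSpace.basisFun (Fin 3) ℝ i)⟫| ≤ 3 * (‖φ‖ * ‖ψ‖) := by
  set b := EuclideanSpace.basisFun (Fin 3) ℝ with hb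
  have hterm : ∀ i : Fin 3, |⟪φ (b i), ψ (b i)⟫| ≤ ‖φ‖ * ‖ψ‖ := fun i => by
    refine (abs_real_inner_le_norm _ _).trans ?_
    have h1 : ‖φ (b i)‖ ≤ ‖φ‖ := by
      have := φ.le_opNorm (b i); rwa [norm_basisFun_eq_one, mul_one] at this
    have h2 : ‖ψ (b i)‖ ≤ ‖ψ‖ := by
      have := ψ.le_opNorm (b i); rwa [norm_basisFun_eq_one, mul_one] at this
    exact mul_le_mul h1 h2 (norm_nonneg _) (norm_nonneg _)
  calc |∑ i : Fin 3, ⟪φ (b i), ψ (b i)⟫| ≤ ∑ i : Fin 3, |⟪φ (b i), ψ (b i)⟫| := Finset.abs_sum_le_sum_abs _ _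
    _ ≤ ∑ _i : Fin 3, ‖φ‖ * ‖ψ‖ := Finset.sum_le_sum fun i _ => hterm i
    _ = 3 * (‖φ‖ * ‖ψ‖) := by rw [Finset.sum_const, Finset.card_univ, Fintype.card_fin, nsmul_eq_mul, Nat.cast_ofNat]

variable {φ ψ : EuclideanSpace ℝ (Fin 3) → (EuclideanSpace ℝ (Fin 3) →L[ℝ] EuclideanSpace ℝ (Fin 3))}

/-- The pairing of two continuous `L²` maps is integrable. [folklore] -/
theorem integrable_sum_inner_apply (hφc : Continuous φ) (hψc : Continuous ψ)
    (hφ : MemLp φ 2 (volume : Measure (EuclideanSpace ℝ (Fin 3)))) (hψ : MemLp ψ 2 (volume : Measure (EuclideanSpace ℝ (Fin 3)))) :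
    Integrable (fun x => ∑ i : Fin 3, ⟪φ x (EuclideanSpace.basisFun (Fin 3) ℝ i), ψ x (EuclideanSpace.basisFun (Fin 3) ℝ i)⟫)
      (volume : Measure (EuclideanSpace ℝ (Fin 3))) := by
  have hc : Continuous fun x => ∑ i : Fin 3, ⟪φ x (EuclideanSpace.basisFun (Fin 3) ℝ i), ψ x (EuclideanSpace.basisFun (Fin 3) ℝ i)⟫ :=
    continuous_finsetSum _ fun i _ => (hφc.clm_apply continuous_const).inner (hψc.clm_apply continuous_const)
  refine ((hφ.norm.integrable_mul hψ.norm).const_mul 3).mono' hc.aestronglyMeasurable (Eventually.of_forall fun x => ?_)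
  rw [Real.norm_eq_abs]
  exact abs_sum_inner_apply_le (φ x) (ψ x)

/-- **Cauchy–Schwarz for the pairing**: `|∫Σᵢ⟪φ bᵢ, ψ bᵢ⟫| ≤ 3·√(∫‖φ‖²)·√(∫‖ψ‖²)`. [folklore] -/
theorem abs_integral_sum_inner_apply_le (hφc : Continuous φ) (hψc : Continuous ψ)
    (hφ : MemLp φ 2 (volume : Measure (EuclideanSpace ℝ (Fin 3)))) (hψ : MemLp ψ 2 (volume : Measure (EuclideanSpace ℝ (Fin 3)))) :
    |∫ x, ∑ i : Fin 3, ⟪φ x (EuclideanSpace.basisFun (Fin 3) ℝ i), ψ x (EuclideanSpace.basisFun (Fin 3) ℝ i)⟫| ≤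
      3 * Real.sqrt (∫ x, ‖φ x‖ ^ 2) * Real.sqrt (∫ x, ‖ψ x‖ ^ 2) := by
  have i1 := integrable_sum_inner_apply hφc hψc hφ hψ
  have h1 : |∫ x, ∑ i : Fin 3, ⟪φ x (EuclideanSpace.basisFun (Fin 3) ℝ i), ψ x (EuclideanSpace.basisFun (Fin 3) ℝ i)⟫| ≤
      ∫ x, 3 * (‖φ x‖ * ‖ψ x‖) :=
    (abs_integral_le_integral_abs).trans (integral_mono_of_nonneg (Eventually.of_forall fun x => abs_nonneg _)
      ((hφ.norm.integrable_mul hψ.norm).const_mul 3) (Eventually.of_forall fun x => abs_sum_inner_apply_le (φ x) (ψ x)))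
  have h2 := integral_mul_le_Lp_mul_Lq_of_nonneg Real.HolderConjugate.two_two
    (ae_of_all _ fun x => norm_nonneg (φ x)) (ae_of_all _ fun x => norm_nonneg (ψ x))
    (by simpa using hφ.norm) (by simpa using hψ.norm)
  have h3 : (∫ x, ‖φ x‖ * ‖ψ x‖) ≤ Real.sqrt (∫ x, ‖φ x‖ ^ 2) * Real.sqrt (∫ x, ‖ψ x‖ ^ 2) := by
    refine h2.trans_eq ?_
    simp only [Real.rpow_two, one_div, Real.sqrt_eq_rpow]
  rw [integral_const_mul] at h1
  calc _ ≤ 3 * ∫ x, ‖φ x‖ * ‖ψ x‖ := h1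
    _ ≤ 3 * (Real.sqrt (∫ x, ‖φ x‖ ^ 2) * Real.sqrt (∫ x, ‖ψ x‖ ^ 2)) := mul_le_mul_of_nonneg_left h3 (by norm_num)
    _ = _ := by ring

/-- **Pairings with an `L²`-convergent family converge**: if `∫‖Ψ_h − Ψ₀‖² → 0` along `l` (all maps continuous and
in `L²`), then `∫Σᵢ⟪φ bᵢ, Ψ_h bᵢ⟫ → ∫Σᵢ⟪φ bᵢ, Ψ₀ bᵢ⟫`. [folklore] -/
theorem tendsto_integral_sum_inner_apply {Ψ : ℝ → EuclideanSpace ℝ (Fin 3) → (EuclideanSpace ℝ (Fin 3) →L[ℝ] EuclideanSpace ℝ (Fin 3))}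
    {Ψ₀ : EuclideanSpace ℝ (Fin 3) → (EuclideanSpace ℝ (Fin 3) →L[ℝ] EuclideanSpace ℝ (Fin 3))} {l : Filter ℝ}
    (hφc : Continuous φ) (hφ : MemLp φ 2 (volume : Measure (EuclideanSpace ℝ (Fin 3))))
    (hΨc : ∀ᶠ h in l, Continuous (Ψ h)) (hΨ : ∀ᶠ h in l, MemLp (Ψ h) 2 (volume : Measure (EuclideanSpace ℝ (Fin 3))))
    (hΨ₀c : Continuous Ψ₀) (hΨ₀ : MemLp Ψ₀ 2 (volume : Measure (EuclideanSpace ℝ (Fin 3))))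
    (hlim : Tendsto (fun h => ∫⁻ x, ‖Ψ h x - Ψ₀ x‖ₑ ^ 2) l (𝓝 0)) :
    Tendsto (fun h => ∫ x, ∑ i : Fin 3, ⟪φ x (EuclideanSpace.basisFun (Fin 3) ℝ i), Ψ h x (EuclideanSpace.basisFun (Fin 3) ℝ i)⟫) l
      (𝓝 (∫ x, ∑ i : Fin 3, ⟪φ x (EuclideanSpace.basisFun (Fin 3) ℝ i), Ψ₀ x (EuclideanSpace.basisFun (Fin 3) ℝ i)⟫)) := by
  set b := EuclideanSpace.basisFun (Fin 3) ℝ with hb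
  have hTr : Tendsto (fun h => (∫⁻ x, ‖Ψ h x - Ψ₀ x‖ₑ ^ 2).toReal) l (𝓝 0) := by
    have h0 := (ENNReal.tendsto_toReal ENNReal.zero_ne_top).comp hlim
    rwa [ENNReal.toReal_zero] at h0
  have hbound : Tendsto (fun h => 3 * Real.sqrt (∫ x, ‖φ x‖ ^ 2) * Real.sqrt ((∫⁻ x, ‖Ψ h x - Ψ₀ x‖ₑ ^ 2).toReal)) l (𝓝 0) := by
    have hs := (Real.continuous_sqrt.tendsto 0).comp hTr
    rw [Real.sqrt_zero] at hs
    have := hs.const_mul (3 * Real.sqrt (∫ x, ‖φ x‖ ^ 2))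
    rwa [mul_zero] at this
  rw [← tendsto_sub_nhds_zero_iff]
  refine squeeze_zero_norm' ?_ hbound
  filter_upwards [hΨc, hΨ] with h hc hm
  have hdc : Continuous fun x => Ψ h x - Ψ₀ x := hc.sub hΨ₀c
  have hdm : MemLp (fun x => Ψ h x - Ψ₀ x) 2 (volume : Measure (EuclideanSpace ℝ (Fin 3))) := hm.sub hΨ₀
  have i1 := integrable_sum_inner_apply hφc hc hφ hm
  have i0 := integrable_sum_inner_apply hφc hΨ₀c hφ hΨ₀
  rw [← integral_sub i1 i0]
  have hpt : ∀ x, (∑ i : Fin 3, ⟪φ x (b i), Ψ h x (b i)⟫) - ∑ i : Fin 3, ⟪φ x (b i), Ψ₀ x (b i)⟫ =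
      ∑ i : Fin 3, ⟪φ x (b i), (Ψ h x - Ψ₀ x) (b i)⟫ := fun x => by
    rw [← Finset.sum_sub_distrib]
    refine Finset.sum_congr rfl fun i _ => ?_
    rw [sub_apply, inner_sub_right]
  rw [integral_congr_ae (Eventually.of_forall hpt), Real.norm_eq_abs]
  refine (abs_integral_sum_inner_apply_le hφc hdc hφ hdm).trans (le_of_eq ?_)
  rw [integral_sq_norm_eq_toReal_lintegral hdc.aestronglyMeasurable]

end ExtremiserLiouville

end Summit.NavierStokesRegularity.NavierStokesRegularity.Theorems

end
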